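import Mathlib
import Literature.Computability.AlgebraicComplexity.MatrixMultiplicationExponent
import Literature.Computability.AlgebraicComplexity.AsymptoticSpectrum
import Literature.Computability.AlgebraicComplexity.SchoenhageTau
import Literature.Computability.AlgebraicComplexity.AsymptoticRankZariskiClosedProofs

/-!
# MatrixMultiplication / HesseHammingShells — the split of `ShellUniformity`
(stmt-MatrixMultiplication-5156) at the signed table `T_{(1,-1,-1)}`

Crux-strategist decomposition (BC2 redirect) of the route's deciding crux

  `ShellUniformity` : `∀ ε > 0 ∃ C ∀ N ∀ m ≤ N, bR(H_m^{(N)}) ≤ C · 3^{(1+ε)N}`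

(`H_m^{(N)}` = radius-`m` Hamming shell of the `Z_3^N` addition table, `bR = algBorderRank`) into

* `SignedTableARC`        — `R̃(T_{-1}) ≤ 3` for the SIGNED addition table
  `T_{-1}(x,y,z) = [x+y+z=0]·(-1)^{[x≠y]}` (the Hesse-pencil member `s = -1`, a smooth
  non-equianharmonic cubic: neither a unit point `s ∈ {0,1,ω,ω²}` nor a triangle point
  `s ∈ {-1/2,-ω/2,-ω²/2,∞}`);
* `SignedTableGeneric`    — `∀ s, R̃(T_s) ≤ R̃(T_{-1})`: the parameter `-1` is not one of the finitely
  many exceptional points of the pencil for the (Zariski upper-semicontinuous, CHNVZ 2025 Thm 1.2)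
  asymptotic rank;
* `PencilDominatesShells` — `∃ s⋆ ∀ N ∀ m ≤ N, bR(H_m^{(N)}) ≤ (N+1) · bR(T_{s⋆}^{⊠N})`: one pencil
  member border-dominates every shell at every degree (theorem-grade: Alder's theorem — tree,
  `alder_secantVariety_eq_setOf_algBorderRank_le_holds` — makes `{s : bR(T_s^{⊠N}) ≤ r}` finite or
  all of `ℂ`; `ℂ` is uncountable, so one `s⋆` is border-generic in every degree; the shells are
  Vandermonde combinations of `N+1` pencil powers `T_s^{⊠N} = Σ_m s^m H_m^{(N)}`).

and the PROVED assembly `shellUniformity_of_subs : X₁ → X₂ → X₃ → ShellUniformity` below: take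
`s⋆` from `X₃`; `X₂` and `X₁` give `R̃(T_{s⋆}) ≤ R̃(T_{-1}) ≤ 3 < 3^{1+ε/2}`; growth from one power
(`exists_const_tensorRank_kroneckerPow_le`, CHNVZ Thm 2.2 proof, tree) gives
`R(T_{s⋆}^{⊠N}) ≤ C₁ 3^{(1+ε/2)N}`; `bR ≤ R` (`algBorderRank_le_tensorRank`); and the interpolation
factor is absorbed, `N + 1 ≤ C₂ 3^{(ε/2)N}` (Bernoulli).  The statement is spelled STRUCTURALLY
(verbatim bodies of the route decls, no import of the Theses file) so that the gate can link it as
`--glue-by` inside `Theses/HesseHammingShells.lean`.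
-/

set_option linter.dupNamespace false

noncomputable section

namespace Summit.MatrixMultiplication.MatrixMultiplication.Theorems

open scoped BigOperators Topology Manifold Classical MeasureTheory ProbabilityTheory Matrix InnerProductSpace ComplexConjugate ContinuousMap
open Filter Set Function TopologicalSpace MeasureTheory
open Literature.Computability.AlgebraicComplexity

/-- A linear factor is absorbed by any exponential: for `b > 1`, `N + 1 ≤ ((b-1)⁻¹ + 1) · b^N`
for all `N` (Bernoulli's inequality `1 + N(b-1) ≤ b^N`). -/
theorem hesseSplit_succ_le_const_mul_pow {b : ℝ} (hb : 1 < b) :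
    ∃ C : ℝ, 0 < C ∧ ∀ N : ℕ, (N : ℝ) + 1 ≤ C * b ^ N := by
  have hb1 : 0 < b - 1 := sub_pos.2 hb
  refine ⟨(b - 1)⁻¹ + 1, by positivity, fun N => ?_⟩
  have hB : 1 + (N : ℝ) * (b - 1) ≤ b ^ N := by
    have h := one_add_mul_le_pow (show (-2 : ℝ) ≤ b - 1 by linarith) N
    rwa [add_sub_cancel] at h
  have h1 : (1 : ℝ) ≤ b ^ N := one_le_pow₀ hb.le
  have hN : (N : ℝ) ≤ (b - 1)⁻¹ * b ^ N := by
    rw [inv_mul_eq_div, le_div_iff₀ hb1]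
    linarith
  calc (N : ℝ) + 1 ≤ (b - 1)⁻¹ * b ^ N + b ^ N := add_le_add hN h1
    _ = ((b - 1)⁻¹ + 1) * b ^ N := by ring

/-- **The split glue** (BC2 redirect of `ShellUniformity`, stmt-MatrixMultiplication-5156):
`SignedTableARC → SignedTableGeneric → PencilDominatesShells → ShellUniformity`, all four spelled
structurally.  Proof: the border-generic member `s⋆` of `PencilDominatesShells` has
`R̃(T_{s⋆}) ≤ R̃(T_{-1}) ≤ 3 < 3^{1+ε/2}`, hence `R(T_{s⋆}^{⊠N}) ≤ C₁ 3^{(1+ε/2)N}`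
(`exists_const_tensorRank_kroneckerPow_le`), `bR ≤ R`, and `(N+1) C₁ 3^{(1+ε/2)N} ≤ C₂ C₁ 3^{(1+ε)N}`. -/
theorem shellUniformity_of_subs
    (h₁ : Literature.Computability.AlgebraicComplexity.asymptoticRank (fun x y z : Fin 3 => if x + y + z = 0 then (if x = y then (1 : ℂ) else (-1 : ℂ)) else 0) ≤ 3)
    (h₂ : ∀ s : ℂ, Literature.Computability.AlgebraicComplexity.asymptoticRank (fun x y z : Fin 3 => if x + y + z = 0 then (if x = y then (1 : ℂ) else s) else 0) ≤ Literature.Computability.AlgebraicComplexity.asymptoticRank (fun x y z : Fin 3 => if x + y + z = 0 then (if x = y then (1 : ℂ) else (-1 : ℂ)) else 0))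
    (h₃ : ∃ s : ℂ, ∀ N m : ℕ, m ≤ N → Literature.Computability.AlgebraicComplexity.algBorderRank (fun x y z : Fin N → Fin 3 => if (∀ i, x i + y i + z i = 0) ∧ (Finset.univ.filter (fun i => x i ≠ y i)).card = m then (1 : ℂ) else 0) ≤ (N + 1) * Literature.Computability.AlgebraicComplexity.algBorderRank (Literature.Computability.AlgebraicComplexity.kroneckerPow (fun x y z : Fin 3 => if x + y + z = 0 then (if x = y then (1 : ℂ) else s) else 0) N)) :
    ∀ ε : ℝ, 0 < ε → ∃ C : ℝ, ∀ N m : ℕ, m ≤ N → (Literature.Computability.AlgebraicComplexity.algBorderRank (fun x y z : Fin N → Fin 3 => if (∀ i, x i + y i + z i = 0) ∧ (Finset.univ.filter (fun i => x i ≠ y i)).card = m then (1 : ℂ) else 0) : ℝ) ≤ C * (3 : ℝ) ^ ((1 + ε) * N) := by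
  obtain ⟨s₀, hs₀⟩ := h₃
  intro ε hε
  -- the border-generic member and its asymptotic rank
  have hR : asymptoticRank (fun x y z : Fin 3 => if x + y + z = 0 then (if x = y then (1 : ℂ) else s₀) else 0) ≤ 3 :=
    (h₂ s₀).trans h₁
  -- rates `3^(ε/2) > 1` and `3^(1+ε/2) > 3`
  have hb : (1 : ℝ) < (3 : ℝ) ^ (ε / 2) := Real.one_lt_rpow (by norm_num) (by positivity)
  have hρ : (3 : ℝ) < (3 : ℝ) ^ (1 + ε / 2) := by
    have h := Real.rpow_lt_rpow_of_exponent_lt (show (1 : ℝ) < 3 by norm_num)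
      (show (1 : ℝ) < 1 + ε / 2 by linarith)
    rwa [Real.rpow_one] at h
  -- growth of the powers of the generic member, from one power (CHNVZ Thm 2.2 proof, tree)
  obtain ⟨C₁, hC₁, hgrowth⟩ := exists_const_tensorRank_kroneckerPow_le
    (fun x y z : Fin 3 => if x + y + z = 0 then (if x = y then (1 : ℂ) else s₀) else 0)
    (by positivity : (0 : ℝ) < (3 : ℝ) ^ (1 + ε / 2)) (hR.trans_lt hρ)
  -- the interpolation factor `N + 1` is absorbed by `3^((ε/2) N)`
  obtain ⟨C₂, hC₂, hlin⟩ := hesseSplit_succ_le_const_mul_pow hb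
  refine ⟨C₂ * C₁, fun N m hm => ?_⟩
  have hnat := hs₀ N m hm
  have hbr : (algBorderRank (kroneckerPow
      (fun x y z : Fin 3 => if x + y + z = 0 then (if x = y then (1 : ℂ) else s₀) else 0) N) : ℝ) ≤
      tensorRank (kroneckerPow
        (fun x y z : Fin 3 => if x + y + z = 0 then (if x = y then (1 : ℂ) else s₀) else 0) N) := by
    exact_mod_cast algBorderRank_le_tensorRank _
  have hpow : ((3 : ℝ) ^ (ε / 2)) ^ N * ((3 : ℝ) ^ (1 + ε / 2)) ^ N = (3 : ℝ) ^ ((1 + ε) * N) := by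
    rw [← Real.rpow_natCast ((3 : ℝ) ^ (ε / 2)) N, ← Real.rpow_natCast ((3 : ℝ) ^ (1 + ε / 2)) N,
      ← Real.rpow_mul (by norm_num : (0 : ℝ) ≤ 3), ← Real.rpow_mul (by norm_num : (0 : ℝ) ≤ 3),
      ← Real.rpow_add (by norm_num : (0 : ℝ) < 3)]
    congr 1
    ring
  calc (algBorderRank (fun x y z : Fin N → Fin 3 => if (∀ i, x i + y i + z i = 0) ∧
          (Finset.univ.filter (fun i => x i ≠ y i)).card = m then (1 : ℂ) else 0) : ℝ)
      ≤ ((N : ℝ) + 1) * (algBorderRank (kroneckerPow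
          (fun x y z : Fin 3 => if x + y + z = 0 then (if x = y then (1 : ℂ) else s₀) else 0) N) : ℝ) := by
        exact_mod_cast hnat
    _ ≤ (C₂ * ((3 : ℝ) ^ (ε / 2)) ^ N) * (C₁ * ((3 : ℝ) ^ (1 + ε / 2)) ^ N) :=
        mul_le_mul (hlin N) (hbr.trans (hgrowth N)) (by positivity) (by positivity)
    _ = (C₂ * C₁) * (((3 : ℝ) ^ (ε / 2)) ^ N * ((3 : ℝ) ^ (1 + ε / 2)) ^ N) := by ring
    _ = (C₂ * C₁) * (3 : ℝ) ^ ((1 + ε) * N) := by rw [hpow]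

end Summit.MatrixMultiplication.MatrixMultiplication.Theorems

end
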